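import Summits.Ventures.HSemireg.WedgeHankelSubstitutionMoments

/-!
# Venture HSemireg — THE GENERAL LINEAR SUBSTITUTION (6): TORELLI FOR FRAME CHANGES — a substitution that fixes the kernels of THREE node classes at distinct nodes is a HOMOTHETY
# (and homotheties fix every kernel): the action of `PGL₂` on the node kernels is faithful, with trivial pointwise stabiliser of any three nodes

HONEST FRAMING. Part of the Lean index of the computation cell `pub-hsemireg` (seat p10 gen 18, Sunday typer «UNIFORM-IN-n»).
Finite-dimensional EXTERIOR ALGEBRA over a field ONLY: no variety, no cohomology theory, no sheaf, no Ext group, no semiregularity map;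
nothing here says that HC / HC_CM / HC_AV holds; no Literature fact is declared or used.  Custodian versions as in `WedgeHankelSiegelIdeal` (1/3) and `WedgeHankelFrameChange`;
the dictionary (a change of the complex frame is determined, up to scale, by what it does to three node kernels; a Möbius map with three fixed points is the identity) is QUOTED,
never asserted.

WHAT IS IN THE TREE.  H5 `Kr_Sb_w_expMul_eq_iff` (a substitution fixes the kernel of a node class of exact order `P < k` iff the node is a fixed point of its Möbius map
`ν ↦ (β + νδ)/(α + νγ)`), H1 `Sb_w` / `sbSeq`, gen 13 `Kr_smul`.  THIS FILE (namespace `Summit.Ventures.HSemireg.Wedge.HankelFrameChange` continued):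
* §155 **`mobius_fixed_three`**: three distinct fixed points `β + λ_iδ = λ_i(α + λ_iγ)` force `β = 0`, `γ = 0`, `α = δ` (the fixed-point quadratic `γν² + (α−δ)ν − β` has three roots);
  `sbSeq_scalar` (`sbSeq α 0 0 α m q j = α^m q_j`, `j ≤ m`), **`Sb_scalar_w`** (`Sb α 0 0 α (w_m q) = α^m · w_m q`), **`Kr_Sb_scalar_w`** (homotheties fix every kernel of every class).
* §156 **`Sb_homothety_of_three_fixed_kernels`**: if `Sb α β γ δ` (`αδ − βγ ≠ 0`) fixes the degree-`k` kernels of three node classes `exp(λ_iΘ)·p_i(Θ)` at DISTINCT nodes `λ_1, λ_2, λ_3`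
  (exact orders `P_i < k`, `k + P_i ≤ n`, `α + λ_iγ ≠ 0`), then `β = 0 ∧ γ = 0 ∧ α = δ` — TORELLI FOR FRAME CHANGES: the substitution is a homothety, hence (§155) fixes EVERY kernel;
  **`Sb_fixes_all_kernels_of_three`** (the dichotomy packaged: three node kernels fixed ⇒ all kernels of all classes fixed).
NOT typed here: the same with a node at `∞` among the three (E7/H2 names plug in); two fixed nodes (the stabiliser is then a one-parameter torus `ν ↦` fixed, e.g. `Δs`-type);
anything Ext-side.  Class side only; new names only.
-/

open Module

namespace Summit.Ventures.HSemireg.Wedge.HankelFrameChange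

open Summit.Ventures.HSemireg.Wedge Summit.Ventures.HSemireg.Wedge.Kunneth Summit.Ventures.HSemireg.Wedge.Hankel
  Summit.Ventures.HSemireg.Wedge.BasisFree Summit.Ventures.HSemireg.Wedge.HankelSiegel Summit.Ventures.HSemireg.Wedge.HankelSiegelIdeal
  Summit.Ventures.HSemireg.Wedge.KunnethKernel Summit.Ventures.HSemireg.Wedge.HankelRankOne

variable (K : Type*) [Field K] {n : ℕ}

/-! ## §155. Three fixed points; homotheties -/

omit [Field K] in
/-- **A MÖBIUS MAP WITH THREE DISTINCT FIXED POINTS IS THE IDENTITY**: `β + λ_iδ = λ_i(α + λ_iγ)` for distinct `λ_1, λ_2, λ_3` forces `β = 0`, `γ = 0`, `α = δ`. -/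
theorem mobius_fixed_three {F : Type*} [Field F] {α β γ δ l₁ l₂ l₃ : F} (h₁₂ : l₁ ≠ l₂) (h₁₃ : l₁ ≠ l₃) (h₂₃ : l₂ ≠ l₃)
    (e₁ : β + l₁ * δ = l₁ * (α + l₁ * γ)) (e₂ : β + l₂ * δ = l₂ * (α + l₂ * γ)) (e₃ : β + l₃ * δ = l₃ * (α + l₃ * γ)) : β = 0 ∧ γ = 0 ∧ α = δ := by
  have d₁₂ : δ = α + (l₁ + l₂) * γ := by
    have h : (l₁ - l₂) * δ = (l₁ - l₂) * (α + (l₁ + l₂) * γ) := by linear_combination e₁ - e₂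
    exact mul_left_cancel₀ (sub_ne_zero.mpr h₁₂) h
  have d₁₃ : δ = α + (l₁ + l₃) * γ := by
    have h : (l₁ - l₃) * δ = (l₁ - l₃) * (α + (l₁ + l₃) * γ) := by linear_combination e₁ - e₃
    exact mul_left_cancel₀ (sub_ne_zero.mpr h₁₃) h
  have hγ : γ = 0 := by
    have h : (l₂ - l₃) * γ = 0 := by linear_combination d₁₃ - d₁₂
    exact (mul_eq_zero.mp h).resolve_left (sub_ne_zero.mpr h₂₃)
  have hαδ : α = δ := by rw [d₁₂, hγ, mul_zero, add_zero]
  refine ⟨?_, hγ, hαδ⟩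
  have h : β = l₁ * (α - δ) + l₁ * l₁ * γ := by linear_combination e₁
  rw [h, hαδ, hγ, sub_self, mul_zero, mul_zero, add_zero]

/-- the moment transform of a HOMOTHETY `x ↦ αx`, `y ↦ αy`: `sbSeq α 0 0 α m q j = α^m q_j` (`j ≤ m`). -/
theorem sbSeq_scalar (α : K) : ∀ (m : ℕ) (q : ℕ → K) {j : ℕ}, j ≤ m → sbSeq K α 0 0 α m q j = α ^ m * q j
  | 0, q, 0, _ => by rw [sbSeq_zero_zero, pow_zero, one_mul]
  | m + 1, q, 0, _ => by rw [sbSeq_succ_zero, zero_mul, add_zero, sbSeq_scalar α m q (Nat.zero_le _), pow_succ]; ring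
  | m + 1, q, j + 1, h => by rw [sbSeq_succ_succ, zero_mul, zero_add, sbSeq_scalar α m (shift K q) (by omega), shift_apply, pow_succ]; ring

/-- **a homothety scales th-7's class: `Sb α 0 0 α (w_m q) = α^m · w_m q`** (`m ≤ n`). -/
theorem Sb_scalar_w (α : K) {m : ℕ} (hm : m ≤ n) (q : ℕ → K) : Sb K α 0 0 α (w K n m q) = α ^ m • w K n m q := by
  rw [Sb_w K α 0 0 α hm, ← w_smul]
  exact w_eq_of_agree K m fun j hj => sbSeq_scalar K α m q hj

/-- **HOMOTHETIES FIX EVERY KERNEL: `Kr(univ, Sb α 0 0 α (w_n q), k) = Kr(univ, w_n q, k)`** (`α ≠ 0`; every `q`, `k`). -/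
theorem Kr_Sb_scalar_w {α : K} (hα : α ≠ 0) (q : ℕ → K) (k : ℕ) :
    Kr K Finset.univ (Sb K α 0 0 α (w K n n q)) k = Kr K Finset.univ (w K n n q) k := by
  rw [Sb_scalar_w K α le_rfl, HankelPureKernel.Kr_smul K _ (pow_ne_zero _ hα)]

/-! ## §156. Torelli for frame changes -/

/-- **TORELLI FOR FRAME CHANGES: a substitution (`αδ − βγ ≠ 0`) that fixes the degree-`k` kernels of THREE node classes at DISTINCT nodes `λ_1, λ_2, λ_3` (exact orders `P_i < k`,
`k + P_i ≤ n`, `α + λ_iγ ≠ 0`) is a HOMOTHETY: `β = 0 ∧ γ = 0 ∧ α = δ`** (H5's stabiliser criterion at each node + §155). -/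
theorem Sb_homothety_of_three_fixed_kernels {α β γ δ : K} (hdet : α * δ - β * γ ≠ 0) {lam : Fin 3 → K} (hlam : Function.Injective lam) (ha : ∀ i, α + lam i * γ ≠ 0)
    {k : ℕ} {P : Fin 3 → ℕ} (hPk : ∀ i, P i < k) (hkP : ∀ i, k + P i ≤ n) {q : Fin 3 → ℕ → K} (hq : ∀ i j, P i < j → q i j = 0) (hqP : ∀ i, q i (P i) ≠ 0)
    (hfix : ∀ i, Kr K Finset.univ (Sb K α β γ δ (w K n n (expMul K (lam i) (q i)))) k = Kr K Finset.univ (w K n n (expMul K (lam i) (q i))) k) :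
    β = 0 ∧ γ = 0 ∧ α = δ := by
  have e : ∀ i, β + lam i * δ = lam i * (α + lam i * γ) := fun i =>
    (Kr_Sb_w_expMul_eq_iff K (ha i) hdet (hPk i) (hkP i) (hq i) (hqP i)).mp (hfix i)
  exact mobius_fixed_three (F := K) (hlam.ne (by decide : (0 : Fin 3) ≠ 1)) (hlam.ne (by decide : (0 : Fin 3) ≠ 2)) (hlam.ne (by decide : (1 : Fin 3) ≠ 2)) (e 0) (e 1) (e 2)

/-- **… hence it fixes the kernel of EVERY class in EVERY degree** (three node kernels fixed ⇒ homothety ⇒ all kernels fixed). -/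
theorem Sb_fixes_all_kernels_of_three {α β γ δ : K} (hdet : α * δ - β * γ ≠ 0) {lam : Fin 3 → K} (hlam : Function.Injective lam) (ha : ∀ i, α + lam i * γ ≠ 0)
    {k : ℕ} {P : Fin 3 → ℕ} (hPk : ∀ i, P i < k) (hkP : ∀ i, k + P i ≤ n) {q : Fin 3 → ℕ → K} (hq : ∀ i j, P i < j → q i j = 0) (hqP : ∀ i, q i (P i) ≠ 0)
    (hfix : ∀ i, Kr K Finset.univ (Sb K α β γ δ (w K n n (expMul K (lam i) (q i)))) k = Kr K Finset.univ (w K n n (expMul K (lam i) (q i))) k)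
    (r : ℕ → K) (k' : ℕ) : Kr K Finset.univ (Sb K α β γ δ (w K n n r)) k' = Kr K Finset.univ (w K n n r) k' := by
  obtain ⟨hβ, hγ, hαδ⟩ := Sb_homothety_of_three_fixed_kernels K hdet hlam ha hPk hkP hq hqP hfix
  have hα : α ≠ 0 := by rintro rfl; apply hdet; rw [← hαδ, hβ]; ring
  subst hβ; subst hγ; subst hαδ
  exact Kr_Sb_scalar_w K hα r k'

end Summit.Ventures.HSemireg.Wedge.HankelFrameChange
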